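import Summits.QuantumFields.BalabanUV.Beta.CombChartContactFactor
import Summits.QuantumFields.BalabanUV.Beta.ReflectionLocusSymShift

/-!
# `BalabanUV.Beta.ReflectionLocusCombShift` — binder row D1, RULING R-D1-g35-1 (chart (III′)), brick P4b-ii: **THE (Sr-conj) LETTER OF THE CHART-(III′) LITERAL
# `JsB12CombSh⁰` AT EVERY LEVEL, BY INDUCTION** — `ReflectionLocusSymShift` §4–§5 (RULING R-D1-g28-2 FILE E5, chart (II)) re-run with the slot resolvent
# `G′_j = GcombSh Lc j` in place of `Gsym Lc j`, at an1's TYPED shift `Dsh Lc` (so (Dspr)(Dnull)(Dff)(Dmm)(DG) are THEOREMS and disappear from the statement):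
# from the table letters (V-r) (three border leg pairs against `bhK Lc + Dsh Lc`), (V-ff0), (H-r) ALONE — level 0 by `S0NOfReflection.S0NOf_bref` (resolvent-free),
# the step by `CombChartContactFactor.e3OfK_GcombSh_bref_inl_inl_of_law'` + `StepReflectionRecSlot.SrecOf_succ_bref_of_e3Law` (generic in the resolvent),
# the units locks at the pin `cE = Lc^{d+1}` (`ReflectionLocusSymShift` §1 BY NAME)

HONEST FRAMING (cell charter, verbatim): «discharging BetaPertH makes Balaban's UV stability UNCONDITIONAL — a real constructive-QFT result; it is
NOT the continuum limit and NOT the Clay problem.»  HONEST DEPENDENCY: continuum YM on T⁴ ⇐ BetaPertH ∧ nine spine estimates (0/9 proved); BetaPertH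
⇐ (D1) ∧ (D4) ∧ CAP+tail; G-an2-4 gates asym, D1 and NE2/3/4.  DERIVED cell leaf (β sub-cell, BINDER-OWNERS row D1 OWNER `b2b-balaban-beta-an2`, gen 36).
WHAT ([folklore]): §1 **`hSrC_SrecOf_GcombSh_all`** (generic `d`, odd `Lc`): for every slot data `(V, H)` with (V-r)(V-ff0)(H-r) against `bhK Lc + Dsh Lc`, normalisation
`2·cVH = −cE·Lc^{d+1}` and the locks: ∀ j, the (Sr-conj) law of `SrecOf V H (GcombSh Lc) cE cVH cΛ j` against `bhKStepSh d Lc (Dsh Lc) j` with contact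
`γ j • diagK (ctGenM d (bhK Lc + Dsh Lc) α Lc κ u)`, `γ j = cVH·wVH j∕(stepScale j·Lc^{d+1})`; `hSrC_SrecOf_GcombSh_all_bcj` (locks discharged at the pin);
§2 `d + 1 = 4`: **`hSrC_ScombOf_all`**, **`hSrC_JsB12CombSh0`** — the hypothesis (Sr-conj) of the chart-(III′) row END `CombChartJointEnd.d1Drift_JsB12CombShSym_of_hW_reflLettersRem_D1Tel_D1Rep`
with `c j α κ u := fun p a ↦ γ j * ctGenM 3 (bhK Lc + Dsh Lc) α Lc κ u p a`, `γ j = −(Lc⁸∕2)·wVH 3 Lc j∕(stepScale 3 Lc j·Lc⁴)` (`smul_diagK` form: `γ • diagK g = diagK (γ·g)` is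
`VertexReflectionContact.smul_diagK`).
HONEST: (Sr-conj) of the (III′) literal is REDUCED to the table letters (V-r)(V-ff0)(H-r) about an1's table VALUES — HYPOTHESES here, exactly as in chart (II) (where they are
consumed by ROOT M′ from an1's `SymTablesAn1*` laws downstream); repair-track root classes 0∕4 discharged by this file alone; NOT D1, NOT `BetaPertH`, NOT continuum, NOT Clay.
No statement of Bałaban's papers, no `[cite:]`, no `Prop` fact, no `def`.  Provenance: β sub-cell, unit beta-an2 gen 36, 2026-08-22 (v1); over `CombChartContactFactor` (this gen),
`ReflectionLocusSymShift` (gen 28), `S0NOfReflection`, `StepReflectionRecSlot`, `CombChartStepJets` (P3) BY NAME; no existing file touched.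
-/

open Finset
open scoped BigOperators
open Literature.Probability.LatticeModels (Torus.proj)
open Literature.MathematicalPhysics.QuantumFieldTheory
open Literature.MathematicalPhysics.QuantumFieldTheory.Balaban1983to89
open Literature.MathematicalPhysics.QuantumFieldTheory.Balaban1983to89.Beta
open ExpKernelCalculus (MKer comp VertexFamily)
open PolarizationSign (reflSign)
open KernelReflection (refK refK_apply)
open ResolventReflection (bref Φ)
open OneStepResolventKernel (Fib LocStencil)
open OneStepKernelFamily (KInvStep)
open BalabanStepJetsSucc (mmRead mmRead_inl_inl E2 wE wVH)
open AveragingContoursRooted (ctr ctrOff ctrOff_mem_box)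
open Summit.QuantumFields.BalabanUV.Beta.TameKernelCalculus
open Summit.QuantumFields.BalabanUV.Beta.ChartConjugation (conjV)
open Summit.QuantumFields.BalabanUV.Beta.AxialDressingRooted (one_le_of_neZero)
open Summit.QuantumFields.BalabanUV.Beta.BorderedHessian (bhK bhK_inr_inr bhKStep bhKStep_zero stepScale stepScale_ne_zero diagK conjV_diagK_apply)
open Summit.QuantumFields.BalabanUV.Beta.SpineRooted (e3OfK S0NOf locStencil_SrecOf)
open Summit.QuantumFields.BalabanUV.Beta.WardLocusRecursive (SrecOf SrecOf_zero)
open Summit.QuantumFields.BalabanUV.Beta.WardLocusInduction (wVH_eq_stepScale_sq wE_eq_stepScale_cube)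
open Summit.QuantumFields.BalabanUV.Beta.KernelWardLevels (stepScale_zero)
open Summit.QuantumFields.BalabanUV.Beta.SymmetrisedStepJets (SymTables)
open Summit.QuantumFields.BalabanUV.Beta.SymShiftedSpread (bhKStepSh bhKStepSh_apply bhKStepSh_zero)
open Summit.QuantumFields.BalabanUV.Beta.E3ContactGenerator (ctGenM)
open Summit.QuantumFields.BalabanUV.Beta.StepReflectionRecSlot (SrecOf_succ_bref_of_e3Law)
open Summit.QuantumFields.BalabanUV.Beta.S0NOfReflection (S0NOf_bref)
open Summit.QuantumFields.BalabanUV.Beta.DshAn1 (Dsh Dsh_inl_inl Dsh_inr_inr spr_Dsh)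
open Summit.QuantumFields.BalabanUV.Beta.CombChartStepJets (GcombSh decays_GcombSh ScombOf ScombOf_eq JsComb0Of_S JsB12CombSh0 JsB12CombSh0_eq)
open Summit.QuantumFields.BalabanUV.Beta.CombChartContactFactor (e3OfK_GcombSh_bref_inl_inl_of_law')
open Summit.QuantumFields.BalabanUV.Beta.ReflectionLocusSymShift (wVH_zero gamma_zero locks_of_pin pin_of_bcj bhKStepSh_fm bhKStepSh_mm_agree)
open Summit.QuantumFields.BalabanUV.Beta.E3ContactFactor (bhKStepSh_mf)

noncomputable section

namespace Summit.QuantumFields.BalabanUV.Beta.ReflectionLocusCombShift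

variable {d : ℕ} {Lc : ℕ} [NeZero Lc]

/-! ## §1 The induction: (Sr-conj) at every level for the slotted family over `GcombSh` against the legged border of an1's shift -/

section Induction

variable {V H : Fin (d + 1) → (Fin (d + 1) → ℤ) → MKer (d + 1) (Fib d)}

/-- [folklore] **(Sr-conj) AT EVERY LEVEL FOR `SrecOf V H (GcombSh Lc) cE cVH cΛ` AGAINST `bhKStepSh d Lc (Dsh Lc) j`, FROM THE TABLE LETTERS AND THE LOCKS** (odd `Lc`,
generic `d`): tables (LV)(LH) localised, (V-r) on the three border leg pairs against `bhK Lc + Dsh Lc` with generator `(Lc^{d+1})⁻¹ • diagK (ctGenM d (bhK Lc + Dsh Lc) α Lc κ u)`,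
(V-ff0), (H-r); normalisation `2·cVH = −cE·Lc^{d+1}`; locks `hlock`.  The shift letters of chart (II)'s `hSrC_SrecOf_Gsym_all` are theorems for `Dsh Lc` and the contact law
through `G′_j` is `CombChartContactFactor.e3OfK_GcombSh_bref_inl_inl_of_law'`. -/
theorem hSrC_SrecOf_GcombSh_all (hLc : Odd Lc) (hV : ∀ δ : ℝ, 0 ≤ δ → ∃ C : ℝ, LocStencil V C δ) (hH : ∀ δ : ℝ, 0 ≤ δ → ∃ C : ℝ, VertexFamily H Lc C δ)
    (cE cVH cΛ : ℝ) (hn : 2 * cVH = -(cE * (Lc : ℝ) ^ (d + 1))) (γ : ℕ → ℝ)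
    (hγ : ∀ j, γ j = cVH * wVH d Lc j / (stepScale d Lc j * (Lc : ℝ) ^ (d + 1)))
    (hlock : ∀ j, cE * wE d Lc (j + 1) * (γ j / (stepScale d Lc j * (Lc : ℝ) ^ (d + 1)) * (wVH d Lc (j + 1))⁻¹) = γ (j + 1))
    {α : Fin (d + 1)}
    (hVfm : ∀ (κ' : Fin (d + 1)) (u x z : Fin (d + 1) → ℤ) (β μ : Fin (d + 1)), V κ' (bref α κ' u) x z (Sum.inl β) (Sum.inr μ) =
      (reflSign α κ' • refK (Φ (d := d) Lc α) (V κ' u + conjV (bhK (d := d) Lc + Dsh Lc)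
        ((((Lc : ℝ) ^ (d + 1))⁻¹) • diagK (ctGenM d (bhK Lc + Dsh Lc) α Lc κ' u)))) x z (Sum.inl β) (Sum.inr μ))
    (hVmf : ∀ (κ' : Fin (d + 1)) (u x z : Fin (d + 1) → ℤ) (μ β : Fin (d + 1)), V κ' (bref α κ' u) x z (Sum.inr μ) (Sum.inl β) =
      (reflSign α κ' • refK (Φ (d := d) Lc α) (V κ' u + conjV (bhK (d := d) Lc + Dsh Lc)
        ((((Lc : ℝ) ^ (d + 1))⁻¹) • diagK (ctGenM d (bhK Lc + Dsh Lc) α Lc κ' u)))) x z (Sum.inr μ) (Sum.inl β))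
    (hVmm : ∀ (κ' : Fin (d + 1)) (u x z : Fin (d + 1) → ℤ) (μ μ' : Fin (d + 1)), V κ' (bref α κ' u) x z (Sum.inr μ) (Sum.inr μ') =
      (reflSign α κ' • refK (Φ (d := d) Lc α) (V κ' u + conjV (bhK (d := d) Lc + Dsh Lc)
        ((((Lc : ℝ) ^ (d + 1))⁻¹) • diagK (ctGenM d (bhK Lc + Dsh Lc) α Lc κ' u)))) x z (Sum.inr μ) (Sum.inr μ'))
    (hV0 : ∀ (κ : Fin (d + 1)) (w x z : Fin (d + 1) → ℤ) (β β' : Fin (d + 1)), V κ w x z (Sum.inl β) (Sum.inl β') = 0)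
    (hHr : ∀ (α' μ : Fin (d + 1)) (y : Fin (d + 1) → ℤ), H μ (bref α' μ y) = reflSign α' μ • refK (Φ (d := d) Lc α') (H μ y)) :
    ∀ (j : ℕ) (κ : Fin (d + 1)) (u : Fin (d + 1) → ℤ),
      SrecOf d Lc V H (GcombSh Lc) cE cVH cΛ j κ (bref α κ u) =
        reflSign α κ • refK (Φ Lc α) (SrecOf d Lc V H (GcombSh Lc) cE cVH cΛ j κ u +
          conjV (bhKStepSh d Lc (Dsh Lc) j) (γ j • diagK (ctGenM d (bhK Lc + Dsh Lc) α Lc κ u))) := by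
  have hB : ∀ (x z : Fin (d + 1) → ℤ) (β β' : Fin (d + 1)),
      (bhK (d := d) Lc + Dsh Lc : MKer (d + 1) (Fib d)) x z (Sum.inl β) (Sum.inl β') = bhK Lc x z (Sum.inl β) (Sum.inl β') :=
    fun x z β β' => by rw [Pi.add_apply, Pi.add_apply, Pi.add_apply, Pi.add_apply, Dsh_inl_inl, add_zero]
  intro j
  induction j with
  | zero =>
    intro κ u
    rw [SrecOf_zero, bhKStepSh_zero, hγ, gamma_zero]
    exact S0NOf_bref cΛ hn hB hVfm hVmf hVmm hV0 hHr κ u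
  | succ j ih =>
    intro κ u
    obtain ⟨Cs, δ, hδ, hS⟩ := locStencil_SrecOf (one_le_of_neZero Lc) hV hH (decays_GcombSh Lc) cE cVH cΛ j
    have hQ := fun κ' u' x z β β' => e3OfK_GcombSh_bref_inl_inl_of_law' hLc j hS hδ (γ j) ih κ' u' x z β β'
    have hc : cE * wE d Lc (j + 1) * (γ j * (wVH d Lc (j + 1))⁻¹ / (stepScale d Lc j * (Lc : ℝ) ^ (d + 1))) =
        cVH * wVH d Lc (j + 1) / (stepScale d Lc (j + 1) * (Lc : ℝ) ^ (d + 1)) := by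
      rw [show γ j * (wVH d Lc (j + 1))⁻¹ / (stepScale d Lc j * (Lc : ℝ) ^ (d + 1)) =
        γ j / (stepScale d Lc j * (Lc : ℝ) ^ (d + 1)) * (wVH d Lc (j + 1))⁻¹ by ring, hlock, hγ]
    rw [hγ]
    exact SrecOf_succ_bref_of_e3Law (GcombSh Lc) cE cVH cΛ j (stepScale_ne_zero (j + 1)) (fun x z β μ => bhKStepSh_fm (j + 1) x z β μ)
      (fun x z μ β => bhKStepSh_mf (j + 1) x z μ β) (fun x z μ μ' => bhKStepSh_mm_agree (j + 1) x z μ μ') hVfm hVmf hVmm hV0 hHr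
      (γ j * (wVH d Lc (j + 1))⁻¹ / (stepScale d Lc j * (Lc : ℝ) ^ (d + 1))) hc hQ κ u

/-- [folklore] **THE SAME WITH THE LOCKS DISCHARGED AT THE PIN `cE = Lc^{d+1}`** (then `2·cVH = −cE·Lc^{d+1}` reads `cVH = −Lc^{2(d+1)}/2`). -/
theorem hSrC_SrecOf_GcombSh_all_bcj (hLc : Odd Lc) (hV : ∀ δ : ℝ, 0 ≤ δ → ∃ C : ℝ, LocStencil V C δ) (hH : ∀ δ : ℝ, 0 ≤ δ → ∃ C : ℝ, VertexFamily H Lc C δ)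
    (cΛ : ℝ) {α : Fin (d + 1)}
    (hVfm : ∀ (κ' : Fin (d + 1)) (u x z : Fin (d + 1) → ℤ) (β μ : Fin (d + 1)), V κ' (bref α κ' u) x z (Sum.inl β) (Sum.inr μ) =
      (reflSign α κ' • refK (Φ (d := d) Lc α) (V κ' u + conjV (bhK (d := d) Lc + Dsh Lc)
        ((((Lc : ℝ) ^ (d + 1))⁻¹) • diagK (ctGenM d (bhK Lc + Dsh Lc) α Lc κ' u)))) x z (Sum.inl β) (Sum.inr μ))
    (hVmf : ∀ (κ' : Fin (d + 1)) (u x z : Fin (d + 1) → ℤ) (μ β : Fin (d + 1)), V κ' (bref α κ' u) x z (Sum.inr μ) (Sum.inl β) =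
      (reflSign α κ' • refK (Φ (d := d) Lc α) (V κ' u + conjV (bhK (d := d) Lc + Dsh Lc)
        ((((Lc : ℝ) ^ (d + 1))⁻¹) • diagK (ctGenM d (bhK Lc + Dsh Lc) α Lc κ' u)))) x z (Sum.inr μ) (Sum.inl β))
    (hVmm : ∀ (κ' : Fin (d + 1)) (u x z : Fin (d + 1) → ℤ) (μ μ' : Fin (d + 1)), V κ' (bref α κ' u) x z (Sum.inr μ) (Sum.inr μ') =
      (reflSign α κ' • refK (Φ (d := d) Lc α) (V κ' u + conjV (bhK (d := d) Lc + Dsh Lc)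
        ((((Lc : ℝ) ^ (d + 1))⁻¹) • diagK (ctGenM d (bhK Lc + Dsh Lc) α Lc κ' u)))) x z (Sum.inr μ) (Sum.inr μ'))
    (hV0 : ∀ (κ : Fin (d + 1)) (w x z : Fin (d + 1) → ℤ) (β β' : Fin (d + 1)), V κ w x z (Sum.inl β) (Sum.inl β') = 0)
    (hHr : ∀ (α' μ : Fin (d + 1)) (y : Fin (d + 1) → ℤ), H μ (bref α' μ y) = reflSign α' μ • refK (Φ (d := d) Lc α') (H μ y)) :
    ∀ (j : ℕ) (κ : Fin (d + 1)) (u : Fin (d + 1) → ℤ),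
      SrecOf d Lc V H (GcombSh Lc) ((Lc : ℝ) ^ (d + 1)) (-((Lc : ℝ) ^ (d + 1) * (1 / 2) * (Lc : ℝ) ^ (d + 1))) cΛ j κ (bref α κ u) =
        reflSign α κ • refK (Φ Lc α) (SrecOf d Lc V H (GcombSh Lc) ((Lc : ℝ) ^ (d + 1)) (-((Lc : ℝ) ^ (d + 1) * (1 / 2) * (Lc : ℝ) ^ (d + 1))) cΛ j κ u +
          conjV (bhKStepSh d Lc (Dsh Lc) j) ((-((Lc : ℝ) ^ (d + 1) * (1 / 2) * (Lc : ℝ) ^ (d + 1)) * wVH d Lc j / (stepScale d Lc j * (Lc : ℝ) ^ (d + 1))) •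
            diagK (ctGenM d (bhK Lc + Dsh Lc) α Lc κ u))) := by
  refine hSrC_SrecOf_GcombSh_all hLc hV hH ((Lc : ℝ) ^ (d + 1)) (-((Lc : ℝ) ^ (d + 1) * (1 / 2) * (Lc : ℝ) ^ (d + 1))) cΛ
    (by ring) (fun j => (-((Lc : ℝ) ^ (d + 1) * (1 / 2) * (Lc : ℝ) ^ (d + 1))) * wVH d Lc j / (stepScale d Lc j * (Lc : ℝ) ^ (d + 1))) (fun j => rfl)
    (fun j => ?_) hVfm hVmf hVmm hV0 hHr
  have h := locks_of_pin (d := d) (Lc := Lc) ((Lc : ℝ) ^ (d + 1)) (-((Lc : ℝ) ^ (d + 1) * (1 / 2) * (Lc : ℝ) ^ (d + 1))) (pin_of_bcj _ rfl) j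
  rw [← h]

end Induction

/-! ## §2 `d + 1 = 4`: the (Sr-conj) letter of the chart-(III′) literal at every level -/

section Literal

/-- [folklore] **(Sr-conj) FOR THE (III′) LITERAL'S FIRST-ORDER TABLES `ScombOf tabs Lc⁴ (−Lc⁸∕2) cΛ` AT EVERY LEVEL** (`d + 1 = 4`, the pins of record). -/
theorem hSrC_ScombOf_all {Lc : ℕ} [NeZero Lc] (hLc : Odd Lc) (tabs : SymTables 3 Lc) (cΛ : ℝ) {α : Fin 4}
    (hVfm : ∀ (κ' : Fin 4) (u x z : Fin 4 → ℤ) (β μ : Fin 4), tabs.V κ' (bref α κ' u) x z (Sum.inl β) (Sum.inr μ) =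
      (reflSign α κ' • refK (Φ (d := 3) Lc α) (tabs.V κ' u + conjV (bhK (d := 3) Lc + Dsh Lc)
        ((((Lc : ℝ) ^ 4)⁻¹) • diagK (ctGenM 3 (bhK Lc + Dsh Lc) α Lc κ' u)))) x z (Sum.inl β) (Sum.inr μ))
    (hVmf : ∀ (κ' : Fin 4) (u x z : Fin 4 → ℤ) (μ β : Fin 4), tabs.V κ' (bref α κ' u) x z (Sum.inr μ) (Sum.inl β) =
      (reflSign α κ' • refK (Φ (d := 3) Lc α) (tabs.V κ' u + conjV (bhK (d := 3) Lc + Dsh Lc)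
        ((((Lc : ℝ) ^ 4)⁻¹) • diagK (ctGenM 3 (bhK Lc + Dsh Lc) α Lc κ' u)))) x z (Sum.inr μ) (Sum.inl β))
    (hVmm : ∀ (κ' : Fin 4) (u x z : Fin 4 → ℤ) (μ μ' : Fin 4), tabs.V κ' (bref α κ' u) x z (Sum.inr μ) (Sum.inr μ') =
      (reflSign α κ' • refK (Φ (d := 3) Lc α) (tabs.V κ' u + conjV (bhK (d := 3) Lc + Dsh Lc)
        ((((Lc : ℝ) ^ 4)⁻¹) • diagK (ctGenM 3 (bhK Lc + Dsh Lc) α Lc κ' u)))) x z (Sum.inr μ) (Sum.inr μ'))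
    (hV0 : ∀ (κ : Fin 4) (w x z : Fin 4 → ℤ) (β β' : Fin 4), tabs.V κ w x z (Sum.inl β) (Sum.inl β') = 0)
    (hHr : ∀ (α' μ : Fin 4) (y : Fin 4 → ℤ), tabs.H μ (bref α' μ y) = reflSign α' μ • refK (Φ (d := 3) Lc α') (tabs.H μ y)) :
    ∀ (j : ℕ) (κ : Fin 4) (u : Fin 4 → ℤ),
      ScombOf tabs ((Lc : ℝ) ^ 4) (-((Lc : ℝ) ^ 4 * (1 / 2) * (Lc : ℝ) ^ 4)) cΛ j κ (bref α κ u) =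
        reflSign α κ • refK (Φ Lc α) (ScombOf tabs ((Lc : ℝ) ^ 4) (-((Lc : ℝ) ^ 4 * (1 / 2) * (Lc : ℝ) ^ 4)) cΛ j κ u +
          conjV (bhKStepSh 3 Lc (Dsh Lc) j) ((-((Lc : ℝ) ^ 4 * (1 / 2) * (Lc : ℝ) ^ 4) * wVH 3 Lc j / (stepScale 3 Lc j * (Lc : ℝ) ^ 4)) •
            diagK (ctGenM 3 (bhK Lc + Dsh Lc) α Lc κ u))) := by
  rw [ScombOf_eq]
  exact hSrC_SrecOf_GcombSh_all_bcj (d := 3) hLc tabs.hV tabs.hH cΛ hVfm hVmf hVmm hV0 hHr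

/-- [folklore] **(Sr-conj) FOR THE CHART-(III′) LITERAL `JsB12CombSh0 hLc N tabs cΛ cB` AT EVERY LEVEL** — the hypothesis hSrC of the (III′) row END
(`CombChartJointEnd.d1Drift_JsB12CombShSym_of_hW_reflLettersRem_D1Tel_D1Rep`) with `C j α κ u := γ j • diagK (ctGenM 3 (bhK Lc + Dsh Lc) α Lc κ u)`,
`γ j = −(Lc⁸∕2)·wVH 3 Lc j∕(stepScale 3 Lc j·Lc⁴)`, from the table letters (V-r)(V-ff0)(H-r) and NOTHING ELSE (every shift letter is a theorem for `Dsh Lc`). -/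
theorem hSrC_JsB12CombSh0 {Lc : ℕ} [NeZero Lc] (hLc : Odd Lc) (N : ℕ) (tabs : SymTables 3 Lc) (cΛ cB : ℝ) {α : Fin 4}
    (hVfm : ∀ (κ' : Fin 4) (u x z : Fin 4 → ℤ) (β μ : Fin 4), tabs.V κ' (bref α κ' u) x z (Sum.inl β) (Sum.inr μ) =
      (reflSign α κ' • refK (Φ (d := 3) Lc α) (tabs.V κ' u + conjV (bhK (d := 3) Lc + Dsh Lc)
        ((((Lc : ℝ) ^ 4)⁻¹) • diagK (ctGenM 3 (bhK Lc + Dsh Lc) α Lc κ' u)))) x z (Sum.inl β) (Sum.inr μ))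
    (hVmf : ∀ (κ' : Fin 4) (u x z : Fin 4 → ℤ) (μ β : Fin 4), tabs.V κ' (bref α κ' u) x z (Sum.inr μ) (Sum.inl β) =
      (reflSign α κ' • refK (Φ (d := 3) Lc α) (tabs.V κ' u + conjV (bhK (d := 3) Lc + Dsh Lc)
        ((((Lc : ℝ) ^ 4)⁻¹) • diagK (ctGenM 3 (bhK Lc + Dsh Lc) α Lc κ' u)))) x z (Sum.inr μ) (Sum.inl β))
    (hVmm : ∀ (κ' : Fin 4) (u x z : Fin 4 → ℤ) (μ μ' : Fin 4), tabs.V κ' (bref α κ' u) x z (Sum.inr μ) (Sum.inr μ') =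
      (reflSign α κ' • refK (Φ (d := 3) Lc α) (tabs.V κ' u + conjV (bhK (d := 3) Lc + Dsh Lc)
        ((((Lc : ℝ) ^ 4)⁻¹) • diagK (ctGenM 3 (bhK Lc + Dsh Lc) α Lc κ' u)))) x z (Sum.inr μ) (Sum.inr μ'))
    (hV0 : ∀ (κ : Fin 4) (w x z : Fin 4 → ℤ) (β β' : Fin 4), tabs.V κ w x z (Sum.inl β) (Sum.inl β') = 0)
    (hHr : ∀ (α' μ : Fin 4) (y : Fin 4 → ℤ), tabs.H μ (bref α' μ y) = reflSign α' μ • refK (Φ (d := 3) Lc α') (tabs.H μ y)) :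
    ∀ (j : ℕ) (κ : Fin 4) (u : Fin 4 → ℤ),
      (JsB12CombSh0 hLc N tabs cΛ cB j).S κ (bref α κ u) =
        reflSign α κ • refK (Φ Lc α) ((JsB12CombSh0 hLc N tabs cΛ cB j).S κ u +
          conjV (bhKStepSh 3 Lc (Dsh Lc) j) ((-((Lc : ℝ) ^ 8 / 2) * wVH 3 Lc j / (stepScale 3 Lc j * (Lc : ℝ) ^ 4)) •
            diagK (ctGenM 3 (bhK Lc + Dsh Lc) α Lc κ u))) := by
  intro j κ u
  have h := hSrC_ScombOf_all hLc tabs cΛ hVfm hVmf hVmm hV0 hHr j κ u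
  have e : -((Lc : ℝ) ^ 4 * (1 / 2) * (Lc : ℝ) ^ 4) = -((Lc : ℝ) ^ 8 / 2) := by ring
  rw [e] at h
  rw [JsB12CombSh0_eq, JsComb0Of_S]
  exact h

end Literal

end Summit.QuantumFields.BalabanUV.Beta.ReflectionLocusCombShift

end
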